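import Summits.CriticalPhenomena.PercolationContinuityZ3.Theorems.PercNearOneGluingNoHeavyLowerTailSahiCombTriWAndRectangle

/-!
# Row-splitting certificates for AND-products: admissible weights (Theorem W) and the soundness of `(R*)`-certificates

Support file of the one-cut programme (crux `NoHeavyLowerTail`, stmt-CriticalPhenomena-4575; unit `prim-lf-1` gen 60, memo
`FROM-prim-lf-1-gen60-ONE-BLOCK.md` §2, §3b).  Continuation of `…TriWAndOneBlock` / `…TriWAndRectangle` / `…TriWAndRectRect`.

The three theorems of those files are instances of ONE mechanism, formalised here in general:
* **Theorem W** (`aRowSum_pair`, `aRowSum_mono`, `aRowSum_bounds`): for an up-set `Q ⊆ 2^{γ₂}`, an up-set `B` of the product cube and a weight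
  `w : 2^{γ₂} → ℕ` that is `Q`-ADMISSIBLE — `Σ_{y∈Q} w(y)·([y∈S] − [yᶜ∈S]) ≥ 0` for every up-set `S ⊆ 2^{γ₂}` (equivalently: `w·1_Q` is a non-negative
  element of the dual cone of the `K`-vectors of `Q`; examples: indicators of up-sets, of Kleitman shells, `[·∈A₂]+[·ᶜ∈A₂]` for `Cor_{A₂} ≥ 0`) — the
  weighted row sum `β_w(x) = Σ_{y∈Q} w(y)·δ_B(x⊔y)` is an integer `K`-vector on the first block (increasing, pair condition, `|β_w| ≤ Σ_Q w`).
* **Soundness of row-splitting certificates** (`corP_andProd_nonneg_of_rowSplit`): let `P₁` be an antipode-free up-set with `Cor_{P₁} ≥ 0` and `Q` an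
  up-set.  If the `δ`-vector of an up-set `A` splits on `P₁ × Q` as
  `δ_A(x⊔y) = Σ_i σ_i(x)·w_i(y) + ρ(x⊔y) + (inflow − outflow of an upward transport c)(x⊔y)`
  with `σ_i` bounded integer `K`-vectors on `P₁`, `w_i` `Q`-admissible weights, `ρ : 2^{γ₁⊕γ₂} → ℕ` increasing, and `c p q ≠ 0` only for `p ⊆ q` inside
  `P₁ × Q`, then `Cor_{P₁∧Q}(A,B) ≥ 0` for EVERY up-set `B`.  (Each piece pairs non-negatively with `δ_B`: Theorem W + acuteness of `P₁`
  (`sum_mul_nonneg_of_bounded`), Kleitman on the product cube for the increasing part (`sum_incr_mul_sgnDiff_nonneg`), monotonicity of `δ_B` for the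
  transport.)
This is the kernel side of CONJECTURE (R*) of the memo ("if `Q` is good then every product `K`-configuration splits this way, for every `P₁`"),
which implies (II); an explicit splitting RULE for a block `Q` plus this file is a Lean block theorem for `Q`.
HONEST LABEL: complete proofs, std axioms; infrastructure (no new block is certified here). [this work]
-/

namespace Summit.CriticalPhenomena.PercolationContinuityZ3.Theorems

namespace FiveUpSet

open Finset

variable {γ₁ γ₂ : Type} [DecidableEq γ₁] [Fintype γ₁] [DecidableEq γ₂] [Fintype γ₂]

/-! ### Acuteness against two bounded integer `K`-vectors -/

/-- **Acuteness against two bounded integer `K`-vectors**: on an antipode-free up-set `P₁` with `Cor_{P₁} ≥ 0`, two increasing integer vectors with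
the pair condition and values in `[-m, m]`, `[-m', m']` have non-negative inner product over `P₁` (peel the sign layers of the first, then
`sum_mul_nonneg_of_unit_of_bounded`). [this work] -/
theorem sum_mul_nonneg_of_bounded {P₁ : Finset (Finset γ₁)} (hP : IsUpperSet (P₁ : Set (Finset γ₁))) (hd : Disjoint P₁ (refl P₁))
    (hcor : ∀ U V : Finset (Finset γ₁), IsUpperSet (U : Set (Finset γ₁)) → IsUpperSet (V : Set (Finset γ₁)) → 0 ≤ corP P₁ U V) :
    ∀ (m : ℕ) (w : Finset γ₁ → ℤ), (∀ x ∈ P₁, -(m : ℤ) ≤ w x ∧ w x ≤ m) →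
      (∀ x ∈ P₁, ∀ x' ∈ P₁, x ⊆ x' → w x ≤ w x') → (∀ x ∈ P₁, ∀ x' ∈ P₁, x ∪ x' = univ → 0 ≤ w x + w x') →
      ∀ (m' : ℕ) (k : Finset γ₁ → ℤ), (∀ x ∈ P₁, -(m' : ℤ) ≤ k x ∧ k x ≤ m') →
      (∀ x ∈ P₁, ∀ x' ∈ P₁, x ⊆ x' → k x ≤ k x') → (∀ x ∈ P₁, ∀ x' ∈ P₁, x ∪ x' = univ → 0 ≤ k x + k x') →
      0 ≤ ∑ x ∈ P₁, w x * k x := by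
  intro m
  induction m with
  | zero =>
    intro w hb _ _ m' k _ _ _
    have h0 : ∑ x ∈ P₁, w x * k x = 0 := by
      refine sum_eq_zero fun x hx => ?_
      have := hb x hx
      have hw : w x = 0 := by push_cast at this; omega
      rw [hw, zero_mul]
    rw [h0]
  | succ m ih =>
    intro w hb hwm hwp m' k hb' hkm hkp
    have hsplit : ∑ x ∈ P₁, w x * k x = ∑ x ∈ P₁, layer1 w x * k x + ∑ x ∈ P₁, (w x - layer1 w x) * k x := by
      rw [← sum_add_distrib]
      exact sum_congr rfl fun x _ => by ring
    rw [hsplit]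
    have t1 := sum_mul_nonneg_of_unit_of_bounded hP hd hcor (layer1 w) (fun x _ => layer1_val w x)
      (fun x hx x' hx' h => layer1_mono (hwm x hx x' hx' h)) (fun x hx x' hx' h => layer1_pair (hwp x hx x' hx' h)) m' k hb' hkm hkp
    have t2 := ih (fun x => w x - layer1 w x) (fun x hx => sub_layer1_bounds (hb x hx))
      (fun x hx x' hx' h => sub_layer1_mono (hwm x hx x' hx' h)) (fun x hx x' hx' h => sub_layer1_pair (hwp x hx x' hx' h)) m' k hb' hkm hkp
    linarith

/-! ### Theorem W: admissible weights give `K`-vector row sums -/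

/-- The weighted row sum as a sum of indicator expressions. [this work] -/
theorem aRowSum_eq (w : Finset γ₂ → ℕ) (B : Finset (Finset (γ₁ ⊕ γ₂))) (Q : Finset (Finset γ₂)) (x : Finset γ₁) :
    ∑ y ∈ Q, (w y : ℤ) * sgnDiff B (refl B) (x.disjSum y) = ∑ y ∈ Q, (w y : ℤ) * (ind B (x.disjSum y) - ind B (xᶜ.disjSum yᶜ)) :=
  sum_congr rfl fun y _ => by rw [sgnDiff_refl_eq, compl_disjSum]

omit [Fintype γ₁] in
/-- **Admissibility in action**: for a `Q`-admissible weight `w`, `Σ_{y∈Q} w(y)·([z⊔y∈B] − [z⊔yᶜ∈B]) ≥ 0` (the defining inequality at the up-set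
`S = secR B z`). [this work] -/
theorem sum_admissible_row_nonneg {w : Finset γ₂ → ℕ} {Q : Finset (Finset γ₂)}
    (hw : ∀ S : Finset (Finset γ₂), IsUpperSet (S : Set (Finset γ₂)) → 0 ≤ ∑ y ∈ Q, (w y : ℤ) * (ind S y - ind S yᶜ))
    {B : Finset (Finset (γ₁ ⊕ γ₂))} (hB : IsUpperSet (B : Set (Finset (γ₁ ⊕ γ₂)))) (z : Finset γ₁) :
    0 ≤ ∑ y ∈ Q, (w y : ℤ) * (ind B (z.disjSum y) - ind B (z.disjSum yᶜ)) := by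
  have h := hw (secR B z) (isUpperSet_secR hB z)
  rw [sum_congr rfl fun y _ => by rw [ind_disjSum_sub_eq_sgnDiff_secR, sgnDiff_refl_eq]]
  exact h

/-- Theorem W, monotonicity: the admissible row sum is increasing in `x`. [this work] -/
theorem aRowSum_mono (w : Finset γ₂ → ℕ) {B : Finset (Finset (γ₁ ⊕ γ₂))} (hB : IsUpperSet (B : Set (Finset (γ₁ ⊕ γ₂))))
    (Q : Finset (Finset γ₂)) {x x' : Finset γ₁} (h : x ⊆ x') :
    ∑ y ∈ Q, (w y : ℤ) * sgnDiff B (refl B) (x.disjSum y) ≤ ∑ y ∈ Q, (w y : ℤ) * sgnDiff B (refl B) (x'.disjSum y) := by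
  rw [aRowSum_eq, aRowSum_eq]
  refine sum_le_sum fun y _ => ?_
  have h1 := ind_mono_pt hB (disjSum_mono h (le_refl y))
  have h2 := ind_mono_pt hB (disjSum_mono (compl_subset_compl.2 h) (le_refl yᶜ))
  exact mul_le_mul_of_nonneg_left (by linarith) (by positivity)

/-- Theorem W, bounds: `|β_w(x)| ≤ Σ_{y∈Q} w(y)`. [this work] -/
theorem aRowSum_bounds (w : Finset γ₂ → ℕ) (B : Finset (Finset (γ₁ ⊕ γ₂))) (Q : Finset (Finset γ₂)) (x : Finset γ₁) :
    -((∑ y ∈ Q, w y : ℕ) : ℤ) ≤ ∑ y ∈ Q, (w y : ℤ) * sgnDiff B (refl B) (x.disjSum y) ∧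
      ∑ y ∈ Q, (w y : ℤ) * sgnDiff B (refl B) (x.disjSum y) ≤ ((∑ y ∈ Q, w y : ℕ) : ℤ) := by
  rw [aRowSum_eq]
  push_cast
  constructor
  · rw [← sum_neg_distrib]
    refine sum_le_sum fun y _ => ?_
    have h1 := ind_nonneg_le_one B (x.disjSum y); have h2 := ind_nonneg_le_one B (xᶜ.disjSum yᶜ)
    have hw : (0 : ℤ) ≤ w y := by positivity
    nlinarith
  · refine sum_le_sum fun y _ => ?_
    have h1 := ind_nonneg_le_one B (x.disjSum y); have h2 := ind_nonneg_le_one B (xᶜ.disjSum yᶜ)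
    have hw : (0 : ℤ) ≤ w y := by positivity
    nlinarith

/-- **Theorem W, pair condition**: for a `Q`-admissible weight `w` and up-sets `Q, B`: `x ∪ x' = ⊤ ⟹ β_w(x) + β_w(x') ≥ 0`. [this work] -/
theorem aRowSum_pair {w : Finset γ₂ → ℕ} {Q : Finset (Finset γ₂)}
    (hw : ∀ S : Finset (Finset γ₂), IsUpperSet (S : Set (Finset γ₂)) → 0 ≤ ∑ y ∈ Q, (w y : ℤ) * (ind S y - ind S yᶜ))
    {B : Finset (Finset (γ₁ ⊕ γ₂))} (hB : IsUpperSet (B : Set (Finset (γ₁ ⊕ γ₂)))) {x x' : Finset γ₁} (h : x ∪ x' = univ) :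
    0 ≤ ∑ y ∈ Q, (w y : ℤ) * sgnDiff B (refl B) (x.disjSum y) + ∑ y ∈ Q, (w y : ℤ) * sgnDiff B (refl B) (x'.disjSum y) := by
  have hc : xᶜ ⊆ x' := by
    intro a ha; rw [mem_compl] at ha
    have := mem_univ a; rw [← h, mem_union] at this; tauto
  have hc' : x'ᶜ ⊆ x := by
    intro a ha; rw [mem_compl] at ha
    have := mem_univ a; rw [← h, mem_union] at this; tauto
  rw [aRowSum_eq, aRowSum_eq, ← sum_add_distrib]
  have key : ∀ y ∈ Q,
      (w y : ℤ) * (ind B (x'ᶜ.disjSum y) - ind B (x'ᶜ.disjSum yᶜ)) + (w y : ℤ) * (ind B (xᶜ.disjSum y) - ind B (xᶜ.disjSum yᶜ))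
      ≤ (w y : ℤ) * (ind B (x.disjSum y) - ind B (xᶜ.disjSum yᶜ)) + (w y : ℤ) * (ind B (x'.disjSum y) - ind B (x'ᶜ.disjSum yᶜ)) := by
    intro y _
    have h1 := ind_mono_pt hB (disjSum_mono hc' (le_refl y))
    have h2 := ind_mono_pt hB (disjSum_mono hc (le_refl y))
    have hw0 : (0 : ℤ) ≤ w y := by positivity
    nlinarith
  have hle := sum_le_sum key
  rw [sum_add_distrib] at hle
  have k1 := sum_admissible_row_nonneg (γ₁ := γ₁) hw hB x'ᶜ
  have k2 := sum_admissible_row_nonneg (γ₁ := γ₁) hw hB xᶜ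
  linarith

/-- **Theorem W, conclusion**: a bounded integer `K`-vector `σ` on a good `P₁` pairs non-negatively with the admissible row sum `β_w`. [this work] -/
theorem sum_kvec_mul_aRowSum_nonneg {P₁ : Finset (Finset γ₁)} (hP : IsUpperSet (P₁ : Set (Finset γ₁))) (hd : Disjoint P₁ (refl P₁))
    (hcor : ∀ U V : Finset (Finset γ₁), IsUpperSet (U : Set (Finset γ₁)) → IsUpperSet (V : Set (Finset γ₁)) → 0 ≤ corP P₁ U V)
    {m : ℕ} {σ : Finset γ₁ → ℤ} (hσb : ∀ x ∈ P₁, -(m : ℤ) ≤ σ x ∧ σ x ≤ m)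
    (hσm : ∀ x ∈ P₁, ∀ x' ∈ P₁, x ⊆ x' → σ x ≤ σ x') (hσp : ∀ x ∈ P₁, ∀ x' ∈ P₁, x ∪ x' = univ → 0 ≤ σ x + σ x')
    {w : Finset γ₂ → ℕ} {Q : Finset (Finset γ₂)}
    (hw : ∀ S : Finset (Finset γ₂), IsUpperSet (S : Set (Finset γ₂)) → 0 ≤ ∑ y ∈ Q, (w y : ℤ) * (ind S y - ind S yᶜ))
    {B : Finset (Finset (γ₁ ⊕ γ₂))} (hB : IsUpperSet (B : Set (Finset (γ₁ ⊕ γ₂)))) :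
    0 ≤ ∑ x ∈ P₁, σ x * ∑ y ∈ Q, (w y : ℤ) * sgnDiff B (refl B) (x.disjSum y) :=
  sum_mul_nonneg_of_bounded hP hd hcor m σ hσb hσm hσp (∑ y ∈ Q, w y)
    (fun x => ∑ y ∈ Q, (w y : ℤ) * sgnDiff B (refl B) (x.disjSum y)) (fun x _ => aRowSum_bounds w B Q x)
    (fun _ _ _ _ h => aRowSum_mono w hB Q h) (fun _ _ _ _ h => aRowSum_pair hw hB h)

/-! ### The increasing part: Kleitman on the product cube -/

/-- `Σ_{t∈T} δ_B(t) = #(T ∩ B) − #(T ∩ refl B)`. [this work] -/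
theorem sum_sgnDiff_refl_eq_card_sub (T B : Finset (Finset γ₁)) :
    ∑ t ∈ T, sgnDiff B (refl B) t = ((T ∩ B).card : ℤ) - (T ∩ refl B).card := by
  unfold sgnDiff
  rw [sum_sub_distrib, sum_boole, sum_boole]
  rfl

/-- On an up-set `T`, `Σ_{t∈T} δ_B(t) ≥ 0` for every up-set `B` (Kleitman). [this work] -/
theorem sum_sgnDiff_refl_nonneg_of_isUpperSet {T B : Finset (Finset γ₁)} (hT : IsUpperSet (T : Set (Finset γ₁)))
    (hB : IsUpperSet (B : Set (Finset γ₁))) : 0 ≤ ∑ t ∈ T, sgnDiff B (refl B) t := by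
  rw [sum_sgnDiff_refl_eq_card_sub, sub_nonneg]
  have h := card_refl_inter_le hT hB
  rw [inter_comm (refl B), inter_comm B] at h
  exact_mod_cast h

/-- **Kleitman for an increasing weight**: for an up-set `T`, an up-set `B` and an increasing `ρ : 2^γ → ℕ`, `Σ_{t∈T} ρ(t)·δ_B(t) ≥ 0`
(peel `ρ` into its up-set layers `{ρ ≥ s}`). [this work] -/
theorem sum_incr_mul_sgnDiff_nonneg {T B : Finset (Finset γ₁)} (hT : IsUpperSet (T : Set (Finset γ₁))) (hB : IsUpperSet (B : Set (Finset γ₁))) :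
    ∀ (R : ℕ) (ρ : Finset γ₁ → ℕ), (∀ t, ρ t ≤ R) → (∀ t t' : Finset γ₁, t ⊆ t' → ρ t ≤ ρ t') →
      0 ≤ ∑ t ∈ T, (ρ t : ℤ) * sgnDiff B (refl B) t := by
  intro R
  induction R with
  | zero =>
    intro ρ hb _
    have h0 : ∑ t ∈ T, (ρ t : ℤ) * sgnDiff B (refl B) t = 0 :=
      sum_eq_zero fun t _ => by rw [Nat.le_zero.1 (hb t)]; simp
    rw [h0]
  | succ R ih =>
    intro ρ hb hmono
    -- split off the layer `U = {ρ ≥ 1}` (an up-set): `ρ = 1_U + ρ'` with `ρ'` increasing and `≤ R`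
    have hsplit : ∑ t ∈ T, (ρ t : ℤ) * sgnDiff B (refl B) t
        = ∑ t ∈ T, (if 1 ≤ ρ t then (1 : ℤ) else 0) * sgnDiff B (refl B) t + ∑ t ∈ T, ((ρ t - 1 : ℕ) : ℤ) * sgnDiff B (refl B) t := by
      rw [← sum_add_distrib]
      refine sum_congr rfl fun t _ => ?_
      rw [← add_mul]
      congr 1
      by_cases h1 : 1 ≤ ρ t
      · rw [if_pos h1]; push_cast [Nat.cast_sub h1]; ring
      · rw [if_neg h1]; have : ρ t = 0 := by omega
        rw [this]; simp
    rw [hsplit]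
    have t1 : 0 ≤ ∑ t ∈ T, (if 1 ≤ ρ t then (1 : ℤ) else 0) * sgnDiff B (refl B) t := by
      have e : ∑ t ∈ T, (if 1 ≤ ρ t then (1 : ℤ) else 0) * sgnDiff B (refl B) t
          = ∑ t ∈ T.filter (fun t => 1 ≤ ρ t), sgnDiff B (refl B) t := by
        rw [sum_filter]
        exact sum_congr rfl fun t _ => by split_ifs <;> simp
      rw [e]
      refine sum_sgnDiff_refl_nonneg_of_isUpperSet ?_ hB
      intro t t' htt' ht
      rw [mem_coe, mem_filter] at ht ⊢
      exact ⟨hT htt' ht.1, ht.2.trans (hmono t t' htt')⟩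
    have t2 := ih (fun t => ρ t - 1) (fun t => by have := hb t; omega) (fun t t' h => by have := hmono t t' h; omega)
    linarith

/-! ### The transport part: monotonicity of `δ_B` -/

/-- An upward transport pairs non-negatively with an increasing function: `Σ_{p,q} c(p,q)·(δ_B(q) − δ_B(p)) ≥ 0` when `c(p,q) ≠ 0 ⟹ p ⊆ q`. [this work] -/
theorem sum_transport_nonneg {S : Finset (Finset γ₁)} {B : Finset (Finset γ₁)} (hB : IsUpperSet (B : Set (Finset γ₁)))
    (c : Finset γ₁ → Finset γ₁ → ℕ) (hc : ∀ p q, c p q ≠ 0 → p ⊆ q) :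
    0 ≤ ∑ p ∈ S, ∑ q ∈ S, (c p q : ℤ) * (sgnDiff B (refl B) q - sgnDiff B (refl B) p) := by
  refine sum_nonneg fun p _ => sum_nonneg fun q _ => ?_
  by_cases h : c p q = 0
  · rw [h]; simp
  · exact mul_nonneg (by positivity) (by linarith [sgnDiff_refl_mono hB (hc p q h)])

omit [DecidableEq γ₁] [Fintype γ₁] in
/-- Rearranging inflow minus outflow: `Σ_{t∈S} δ(t)·(Σ_p c(p,t) − Σ_q c(t,q)) = Σ_{p,q∈S} c(p,q)(δ(q) − δ(p))`. [this work] -/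
theorem sum_flow_eq {S : Finset (Finset γ₁)} (c : Finset γ₁ → Finset γ₁ → ℕ) (δ : Finset γ₁ → ℤ) :
    ∑ t ∈ S, δ t * ((∑ p ∈ S, (c p t : ℤ)) - ∑ q ∈ S, (c t q : ℤ))
      = ∑ p ∈ S, ∑ q ∈ S, (c p q : ℤ) * (δ q - δ p) := by
  have h1 : ∑ t ∈ S, δ t * ∑ p ∈ S, (c p t : ℤ) = ∑ p ∈ S, ∑ q ∈ S, (c p q : ℤ) * δ q := by
    rw [show (∑ t ∈ S, δ t * ∑ p ∈ S, (c p t : ℤ)) = ∑ t ∈ S, ∑ p ∈ S, δ t * (c p t : ℤ) from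
      sum_congr rfl fun t _ => Finset.mul_sum _ _ _, Finset.sum_comm]
    exact sum_congr rfl fun p _ => sum_congr rfl fun t _ => by ring
  have h2 : ∑ t ∈ S, δ t * ∑ q ∈ S, (c t q : ℤ) = ∑ p ∈ S, ∑ q ∈ S, (c p q : ℤ) * δ p :=
    sum_congr rfl fun t _ => by rw [Finset.mul_sum]; exact sum_congr rfl fun q _ => by ring
  have h3 : ∑ t ∈ S, δ t * ((∑ p ∈ S, (c p t : ℤ)) - ∑ q ∈ S, (c t q : ℤ))
      = ∑ t ∈ S, δ t * ∑ p ∈ S, (c p t : ℤ) - ∑ t ∈ S, δ t * ∑ q ∈ S, (c t q : ℤ) := by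
    rw [← sum_sub_distrib]; exact sum_congr rfl fun t _ => by ring
  rw [h3, h1, h2, ← sum_sub_distrib]
  exact sum_congr rfl fun p _ => by rw [← sum_sub_distrib]; exact sum_congr rfl fun q _ => by ring

/-! ### Soundness of row-splitting certificates -/

/-- **Soundness of `(R*)`-certificates.**  Let `P₁` be an antipode-free up-set with `Cor_{P₁} ≥ 0`, `Q` an up-set, `A` any family.  Suppose the
`δ`-vector of `A` splits on `P₁ × Q` as
`δ_A(x⊔y) = Σ_i σ_i(x)·w_i(y) + ρ(x⊔y) + Σ_{p ∈ P₁∧Q} c(p, x⊔y) − Σ_{q ∈ P₁∧Q} c(x⊔y, q)`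
with bounded integer `K`-vectors `σ_i` on `P₁`, `Q`-admissible weights `w_i`, an increasing `ρ : 2^{γ₁⊕γ₂} → ℕ`, and an upward transport `c`
(`c p q ≠ 0 ⟹ p ⊆ q`).  Then `Cor_{P₁∧Q}(A,B) ≥ 0` for every up-set `B`. [this work] -/
theorem corP_andProd_nonneg_of_rowSplit {ι : Type} [Fintype ι] [DecidableEq ι]
    {P₁ : Finset (Finset γ₁)} (hP : IsUpperSet (P₁ : Set (Finset γ₁))) (hd : Disjoint P₁ (refl P₁))
    (hcor : ∀ U V : Finset (Finset γ₁), IsUpperSet (U : Set (Finset γ₁)) → IsUpperSet (V : Set (Finset γ₁)) → 0 ≤ corP P₁ U V)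
    {Q : Finset (Finset γ₂)} (hQ : IsUpperSet (Q : Set (Finset γ₂))) (A : Finset (Finset (γ₁ ⊕ γ₂)))
    (m : ℕ) (σ : ι → Finset γ₁ → ℤ) (hσb : ∀ i, ∀ x ∈ P₁, -(m : ℤ) ≤ σ i x ∧ σ i x ≤ m)
    (hσm : ∀ i, ∀ x ∈ P₁, ∀ x' ∈ P₁, x ⊆ x' → σ i x ≤ σ i x') (hσp : ∀ i, ∀ x ∈ P₁, ∀ x' ∈ P₁, x ∪ x' = univ → 0 ≤ σ i x + σ i x')
    (w : ι → Finset γ₂ → ℕ)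
    (hw : ∀ i, ∀ S : Finset (Finset γ₂), IsUpperSet (S : Set (Finset γ₂)) → 0 ≤ ∑ y ∈ Q, (w i y : ℤ) * (ind S y - ind S yᶜ))
    (ρ : Finset (γ₁ ⊕ γ₂) → ℕ) (hρ : ∀ t t' : Finset (γ₁ ⊕ γ₂), t ⊆ t' → ρ t ≤ ρ t')
    (c : Finset (γ₁ ⊕ γ₂) → Finset (γ₁ ⊕ γ₂) → ℕ) (hc : ∀ p q, c p q ≠ 0 → p ⊆ q)
    (hsplit : ∀ x ∈ P₁, ∀ y ∈ Q, sgnDiff A (refl A) (x.disjSum y)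
      = ∑ i, σ i x * (w i y : ℤ) + ρ (x.disjSum y)
        + ((∑ p ∈ andProd P₁ Q, (c p (x.disjSum y) : ℤ)) - ∑ q ∈ andProd P₁ Q, (c (x.disjSum y) q : ℤ)))
    {B : Finset (Finset (γ₁ ⊕ γ₂))} (hB : IsUpperSet (B : Set (Finset (γ₁ ⊕ γ₂)))) :
    0 ≤ corP (andProd P₁ Q) A B := by
  -- the three pieces, as sums over the product
  have hK : 0 ≤ ∑ x ∈ P₁, ∑ y ∈ Q, (∑ i, σ i x * (w i y : ℤ)) * sgnDiff B (refl B) (x.disjSum y) := by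
    have e : ∑ x ∈ P₁, ∑ y ∈ Q, (∑ i, σ i x * (w i y : ℤ)) * sgnDiff B (refl B) (x.disjSum y)
        = ∑ i, ∑ x ∈ P₁, σ i x * ∑ y ∈ Q, (w i y : ℤ) * sgnDiff B (refl B) (x.disjSum y) := by
      have s1 : ∑ x ∈ P₁, ∑ y ∈ Q, (∑ i, σ i x * (w i y : ℤ)) * sgnDiff B (refl B) (x.disjSum y)
          = ∑ x ∈ P₁, ∑ y ∈ Q, ∑ i, σ i x * ((w i y : ℤ) * sgnDiff B (refl B) (x.disjSum y)) :=
        sum_congr rfl fun x _ => sum_congr rfl fun y _ => by rw [Finset.sum_mul]; exact sum_congr rfl fun i _ => by ring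
      have s2 : ∑ x ∈ P₁, ∑ y ∈ Q, ∑ i, σ i x * ((w i y : ℤ) * sgnDiff B (refl B) (x.disjSum y))
          = ∑ x ∈ P₁, ∑ i, ∑ y ∈ Q, σ i x * ((w i y : ℤ) * sgnDiff B (refl B) (x.disjSum y)) :=
        sum_congr rfl fun x _ => Finset.sum_comm
      rw [s1, s2, Finset.sum_comm]
      exact sum_congr rfl fun i _ => sum_congr rfl fun x _ => by rw [Finset.mul_sum]
    rw [e]
    exact sum_nonneg fun i _ => sum_kvec_mul_aRowSum_nonneg hP hd hcor (hσb i) (hσm i) (hσp i) (hw i) hB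
  have hR : 0 ≤ ∑ t ∈ andProd P₁ Q, (ρ t : ℤ) * sgnDiff B (refl B) t := by
    obtain ⟨R, hR⟩ : ∃ R : ℕ, ∀ t, ρ t ≤ R :=
      ⟨univ.sup ρ, fun t => le_sup (mem_univ t)⟩
    exact sum_incr_mul_sgnDiff_nonneg (isUpperSet_andProd hP hQ) hB R ρ hR hρ
  have hM : 0 ≤ ∑ t ∈ andProd P₁ Q, sgnDiff B (refl B) t *
      ((∑ p ∈ andProd P₁ Q, (c p t : ℤ)) - ∑ q ∈ andProd P₁ Q, (c t q : ℤ)) := by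
    rw [sum_flow_eq]
    exact sum_transport_nonneg hB c hc
  -- rewrite `Cor` through the certificate
  rw [corP_andProd_eq_sum_sum]
  have e1 : ∑ x ∈ P₁, ∑ y ∈ Q, sgnDiff A (refl A) (x.disjSum y) * sgnDiff B (refl B) (x.disjSum y)
      = ∑ x ∈ P₁, ∑ y ∈ Q, (∑ i, σ i x * (w i y : ℤ)) * sgnDiff B (refl B) (x.disjSum y)
        + ∑ x ∈ P₁, ∑ y ∈ Q, ((ρ (x.disjSum y) : ℤ) * sgnDiff B (refl B) (x.disjSum y)
          + sgnDiff B (refl B) (x.disjSum y) *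
            ((∑ p ∈ andProd P₁ Q, (c p (x.disjSum y) : ℤ)) - ∑ q ∈ andProd P₁ Q, (c (x.disjSum y) q : ℤ))) := by
    rw [← sum_add_distrib]
    refine sum_congr rfl fun x hx => ?_
    rw [← sum_add_distrib]
    refine sum_congr rfl fun y hy => ?_
    rw [hsplit x hx y hy]
    ring
  have e2 : ∀ f : Finset (γ₁ ⊕ γ₂) → ℤ, ∑ x ∈ P₁, ∑ y ∈ Q, f (x.disjSum y) = ∑ t ∈ andProd P₁ Q, f t := by
    intro f
    rw [andProd_eq_biUnion, sum_biUnion (pairwiseDisjoint_rows P₁ Q)]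
    exact sum_congr rfl fun x _ => by rw [sum_map]; rfl
  rw [e1, e2 (fun t => (ρ t : ℤ) * sgnDiff B (refl B) t + sgnDiff B (refl B) t *
      ((∑ p ∈ andProd P₁ Q, (c p t : ℤ)) - ∑ q ∈ andProd P₁ Q, (c t q : ℤ))), sum_add_distrib]
  linarith

end FiveUpSet

end Summit.CriticalPhenomena.PercolationContinuityZ3.Theorems
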